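import Mathlib
import Summits.NavierStokesRegularity.NavierStokesRegularity.Theorems.FilamentSkeletonRssDefectColumnGateQuasimodeWitness

/-!
# Route `FilamentSkeletonRss` · crux `TransverseReduction1AG` (stmt-NavierStokesRegularity-27853) · line `defect_column_gate_1AG` —
# THE FAR-FIELD QUASIMODE: preliminaries for the pointwise estimate (weights, Gaussian factors, column coefficients, Hermite/Euler identities)

Helper file (`--supports stmt-NavierStokesRegularity-27853 --as helper`; LEAD of 27853, lane ns-filament-21221-p1 g10).  The analytic heart of the owed
construction `FarFieldQuasimodes1A` (memo S2A-FALSE-FARFIELD-27853-g10.md §3): after the exact Hermite cancellation `(gam + 4b₁)p₂ + λ₂yp₃ + p₄ = 0`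
(`s = 5gam/2`), the closed form `colForceVort_farW` consists of the `1/L` dilation commutator, `O(y₀⁻¹)`-decaying profile terms and `O(Rc/y₀)` column terms;
each is bounded in the weight `(1 + y₀² + y₁²)²` by an explicit constant times `1/L` for `L ≥ 1`.
HONEST FRAMING: real analysis on an explicit MODEL operator; MODEL rung, negative side; nothing here bears on Navier–Stokes regularity.
-/

set_option linter.dupNamespace false

noncomputable section

namespace Summit.NavierStokesRegularity.NavierStokesRegularity.Theorems.DefectColumnGate

open scoped BigOperators Topology InnerProductSpace ContDiff
open Set Function Filter
open Literature.Analysis.FluidPDE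
open Summit.NavierStokesRegularity.NavierStokesRegularity.Theorems.KelvinGate

/-! ## 1. Elementary bounds -/

/-- `e^{-L} ≤ 1/L` for `L ≥ 1`. -/
theorem exp_neg_le_inv {L : ℝ} (hL : 1 ≤ L) : Real.exp (-L) ≤ 1 / L := by
  have h1 : L + 1 ≤ Real.exp L := Real.add_one_le_exp L
  rw [Real.exp_neg, one_div]
  exact inv_anti₀ (by linarith) (by linarith)

/-- `(e^{L·k})⁻¹ ≤ e^{-L}` for `k ≥ 1`, `L ≥ 0`. -/
theorem inv_exp_mul_le {L : ℝ} (hL : 0 ≤ L) {k : ℕ} (hk : 1 ≤ k) : (Real.exp L ^ k)⁻¹ ≤ Real.exp (-L) := by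
  rw [Real.exp_neg]
  apply inv_anti₀ (Real.exp_pos _)
  calc Real.exp L = Real.exp L ^ 1 := (pow_one _).symm
    _ ≤ Real.exp L ^ k := pow_le_pow_right₀ (Real.one_le_exp hL) hk

/-- **Weighted profile bound**: for `L ≥ 1`, `|x|^{4+k}|F_k| ≤ M` everywhere, `e^L < |x|`, and `j ≤ k` with `k - j ≥ 1`:
`(1+x²)²·|x|^j·|F_k(x)| ≤ 4M·e^{-L}`. -/
theorem weight_farProfile_le {L M x : ℝ} {k j : ℕ} (hL : 1 ≤ L) (hM : ∀ z, |z| ^ (4 + k) * |farProfile L k z| ≤ M)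
    (hx : Real.exp L < |x|) (hjk : j + 1 ≤ k) :
    (1 + x ^ 2) ^ 2 * |x| ^ j * |farProfile L k x| ≤ 4 * M * Real.exp (-L) := by
  have hx1 : 1 ≤ |x| := le_trans (Real.one_le_exp (by linarith)) hx.le
  have hx0 : 0 < |x| := lt_of_lt_of_le one_pos hx1
  have hM0 : 0 ≤ M := le_trans (by positivity) (hM x)
  have hw := weight_le_four_pow hx1
  obtain ⟨d, hd⟩ := Nat.exists_eq_add_of_le hjk
  -- |x|^(4+k) = |x|^(4+j) * |x|^(d+1)
  have hsplit : |x| ^ (4 + k) = |x| ^ (4 + j) * |x| ^ (d + 1) := by rw [← pow_add]; congr 1; omega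
  have hkey : |x| ^ (4 + j) * |farProfile L k x| ≤ M * (|x| ^ (d + 1))⁻¹ := by
    rw [le_mul_inv_iff₀ (pow_pos hx0 _), mul_right_comm, ← hsplit]; exact hM x
  have hdec : (|x| ^ (d + 1))⁻¹ ≤ Real.exp (-L) :=
    le_trans (inv_anti₀ (pow_pos (Real.exp_pos _) _) (pow_le_pow_left₀ (Real.exp_pos _).le hx.le _))
      (inv_exp_mul_le (by linarith) (by omega))
  calc (1 + x ^ 2) ^ 2 * |x| ^ j * |farProfile L k x| ≤ 4 * |x| ^ 4 * |x| ^ j * |farProfile L k x| := by gcongr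
    _ = 4 * (|x| ^ (4 + j) * |farProfile L k x|) := by rw [pow_add]; ring
    _ ≤ 4 * (M * (|x| ^ (d + 1))⁻¹) := by gcongr
    _ ≤ 4 * (M * Real.exp (-L)) := by gcongr
    _ = 4 * M * Real.exp (-L) := by ring

/-- Same with `j = k` (no decay): `(1+x²)²·|x|^k·|F_k(x)| ≤ 4M` for `|x| ≥ 1`. -/
theorem weight_farProfile_le' {L M x : ℝ} {k : ℕ} (hM : ∀ z, |z| ^ (4 + k) * |farProfile L k z| ≤ M) (hx1 : 1 ≤ |x|) :
    (1 + x ^ 2) ^ 2 * |x| ^ k * |farProfile L k x| ≤ 4 * M := by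
  have hw := weight_le_four_pow hx1
  calc (1 + x ^ 2) ^ 2 * |x| ^ k * |farProfile L k x| ≤ 4 * |x| ^ 4 * |x| ^ k * |farProfile L k x| := by gcongr
    _ = 4 * (|x| ^ (4 + k) * |farProfile L k x|) := by rw [pow_add]; ring
    _ ≤ 4 * M := by gcongr; exact hM x

/-- The `1/L` commutator term: `A(x) = (χ₀′(log x/L)/L)·x⁻⁴` satisfies `(1+x²)²|A(x)| ≤ 4·Md/L` for `|x| ≥ 1`, `|χ₀′| ≤ Md`, `L ≥ 1`. -/
theorem weight_commutator_le {L Md x : ℝ} (hL : 1 ≤ L) (hMd : ∀ t, |deriv bump12 t| ≤ Md) (hx1 : 1 ≤ |x|) :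
    (1 + x ^ 2) ^ 2 * |deriv bump12 (Real.log x / L) / L * (x ^ 4)⁻¹| ≤ 4 * Md / L := by
  have hx0 : 0 < |x| := lt_of_lt_of_le one_pos hx1
  have hL0 : 0 < L := by linarith
  have hw := weight_le_four_pow hx1
  have hMd0 : 0 ≤ Md := le_trans (abs_nonneg _) (hMd 0)
  rw [abs_mul, abs_inv, abs_pow, abs_div, abs_of_pos hL0]
  calc (1 + x ^ 2) ^ 2 * (|deriv bump12 (Real.log x / L)| / L * (|x| ^ 4)⁻¹)
      ≤ 4 * |x| ^ 4 * (Md / L * (|x| ^ 4)⁻¹) := by gcongr; exact hMd _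
    _ = 4 * (Md / L) * (|x| ^ 4 * (|x| ^ 4)⁻¹) := by ring
    _ = 4 * Md / L := by rw [mul_inv_cancel₀ (pow_ne_zero 4 hx0.ne')]; ring

/-- The generic product bound: `wt ≤ wx·wy`, `wx|X| ≤ bx`, `wy|Y| ≤ by` ⇒ `wt·|c·X·Y| ≤ |c|·bx·by`. -/
theorem weight_prod_le {wt wx wy X Y c bx bY : ℝ} (hwt : wt ≤ wx * wy) (hwx : 0 ≤ wx) (hwy : 0 ≤ wy)
    (hX : wx * |X| ≤ bx) (hY : wy * |Y| ≤ bY) : wt * |c * X * Y| ≤ |c| * bx * bY := by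
  have hbx : 0 ≤ bx := le_trans (mul_nonneg hwx (abs_nonneg _)) hX
  rw [abs_mul, abs_mul]
  calc wt * (|c| * |X| * |Y|) ≤ wx * wy * (|c| * |X| * |Y|) := by gcongr
    _ = |c| * (wx * |X|) * (wy * |Y|) := by ring
    _ ≤ |c| * bx * bY := by gcongr

/-! ## 2. The weighted Gaussian factors -/

/-- `CE = 4 + 480·(2/λ₂)^5`: the bound of `weight_pow_gaussE_le` for `λ₂ = 3/10`. -/
def CE : ℝ := 4 + 480 * (2 / lamW) ^ 5

/-- `CE ≥ 0`. -/
theorem CE_nonneg : 0 ≤ CE := by rw [CE, lamW]; positivity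

/-- `(1+v²)²·|v|^j·E(v) ≤ CE` for `j ≤ 5`. -/
theorem wy_pow_le {j : ℕ} (hj : j ≤ 5) (v : ℝ) : (1 + v ^ 2) ^ 2 * (|v| ^ j * gaussE lamW v) ≤ CE := by
  rw [← mul_assoc]; exact weight_pow_gaussE_le lamW_pos hj v

/-- `(1+v²)²·|Y(v)·E(v)|` bounds for the polynomial factors that occur. -/
theorem wy_poly_le (a₀ a₁ a₂ a₃ : ℝ) (v : ℝ) :
    (1 + v ^ 2) ^ 2 * |(a₀ + a₁ * v + a₂ * v ^ 2 + a₃ * v ^ 3) * gaussE lamW v| ≤ (|a₀| + |a₁| + |a₂| + |a₃|) * CE := by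
  have hE := (gaussE_pos lamW v).le
  have h0 := wy_pow_le (j := 0) (by norm_num) v
  have h1 := wy_pow_le (j := 1) (by norm_num) v
  have h2 := wy_pow_le (j := 2) (by norm_num) v
  have h3 := wy_pow_le (j := 3) (by norm_num) v
  have hw : 0 ≤ (1 + v ^ 2) ^ 2 := by positivity
  rw [abs_mul, abs_of_nonneg hE]
  have htri : |a₀ + a₁ * v + a₂ * v ^ 2 + a₃ * v ^ 3| ≤ |a₀| * |v| ^ 0 + |a₁| * |v| ^ 1 + |a₂| * |v| ^ 2 + |a₃| * |v| ^ 3 := by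
    rw [pow_zero, mul_one, pow_one, ← abs_pow, ← abs_pow, ← abs_mul, ← abs_mul, ← abs_mul]
    exact le_trans (abs_add_le _ _) (add_le_add (le_trans (abs_add_le _ _) (add_le_add (abs_add_le _ _) le_rfl)) le_rfl)
  calc (1 + v ^ 2) ^ 2 * (|a₀ + a₁ * v + a₂ * v ^ 2 + a₃ * v ^ 3| * gaussE lamW v)
      ≤ (1 + v ^ 2) ^ 2 * ((|a₀| * |v| ^ 0 + |a₁| * |v| ^ 1 + |a₂| * |v| ^ 2 + |a₃| * |v| ^ 3) * gaussE lamW v) := by gcongr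
    _ = |a₀| * ((1 + v ^ 2) ^ 2 * (|v| ^ 0 * gaussE lamW v)) + |a₁| * ((1 + v ^ 2) ^ 2 * (|v| ^ 1 * gaussE lamW v))
        + |a₂| * ((1 + v ^ 2) ^ 2 * (|v| ^ 2 * gaussE lamW v)) + |a₃| * ((1 + v ^ 2) ^ 2 * (|v| ^ 3 * gaussE lamW v)) := by ring
    _ ≤ |a₀| * CE + |a₁| * CE + |a₂| * CE + |a₃| * CE := by gcongr
    _ = (|a₀| + |a₁| + |a₂| + |a₃|) * CE := by ring

/-! ## 2b. The column coefficients are `≤ Rc` -/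

/-- `0 ≤ cφ ≤ Rc` for `cφ = (gam Rc/8π)·φ(q)`, `q ≥ 0` (`0 < φ ≤ 1`). -/
theorem colCoeff_bounds {Rc : ℝ} (hRc : 0 ≤ Rc) (x v : ℝ) :
    0 ≤ (8/5 - 3/2 : ℝ) * Rc / (8 * Real.pi) * burgersPhi ((8/5 - 3/2) * (x ^ 2 + v ^ 2) / 4) ∧
      (8/5 - 3/2 : ℝ) * Rc / (8 * Real.pi) * burgersPhi ((8/5 - 3/2) * (x ^ 2 + v ^ 2) / 4) ≤ Rc := by
  have hq0 : 0 ≤ (8/5 - 3/2 : ℝ) * (x ^ 2 + v ^ 2) / 4 := by positivity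
  have hφ1 := burgersPhi_le_one hq0
  have hφ0 := (burgersPhi_pos ((8/5 - 3/2 : ℝ) * (x ^ 2 + v ^ 2) / 4)).le
  have hπ : (3:ℝ) < Real.pi := Real.pi_gt_three
  refine ⟨by positivity, ?_⟩
  calc (8/5 - 3/2 : ℝ) * Rc / (8 * Real.pi) * burgersPhi ((8/5 - 3/2) * (x ^ 2 + v ^ 2) / 4)
      ≤ (8/5 - 3/2 : ℝ) * Rc / (8 * Real.pi) * 1 := by gcongr
    _ = Rc * ((8/5 - 3/2 : ℝ) / (8 * Real.pi)) := by ring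
    _ ≤ Rc * 1 := by
        gcongr
        rw [div_le_one (by positivity)]; linarith
    _ = Rc := mul_one _

/-- `cφ·x² ≤ Rc` (from `φ(q) ≤ 1/q`, `q ≥ gam x²/4 > 0`). -/
theorem colCoeff_mul_sq_le {Rc : ℝ} (hRc : 0 ≤ Rc) {x : ℝ} (hx : x ≠ 0) (v : ℝ) :
    (8/5 - 3/2 : ℝ) * Rc / (8 * Real.pi) * burgersPhi ((8/5 - 3/2) * (x ^ 2 + v ^ 2) / 4) * x ^ 2 ≤ Rc := by
  have hπ : (3:ℝ) < Real.pi := Real.pi_gt_three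
  have hx2 : 0 < x ^ 2 := by positivity
  have hqpos : 0 < (8/5 - 3/2 : ℝ) * (x ^ 2 + v ^ 2) / 4 := by positivity
  have hφq := StrainedAzimuthal.burgersPhi_le_inv hqpos
  have hx2' : x ^ 2 ≤ x ^ 2 + v ^ 2 := by nlinarith [sq_nonneg v]
  calc (8/5 - 3/2 : ℝ) * Rc / (8 * Real.pi) * burgersPhi ((8/5 - 3/2) * (x ^ 2 + v ^ 2) / 4) * x ^ 2
      ≤ (8/5 - 3/2 : ℝ) * Rc / (8 * Real.pi) * ((8/5 - 3/2 : ℝ) * (x ^ 2 + v ^ 2) / 4)⁻¹ * (x ^ 2 + v ^ 2) := by gcongr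
    _ = Rc * (1 / (2 * Real.pi)) := by field_simp; ring
    _ ≤ Rc * 1 := by
        gcongr
        rw [div_le_one (by positivity)]; linarith
    _ = Rc := mul_one _

/-- `0 ≤ (gam/2)ζ ≤ Rc` and `ζ ≤ (gam Rc/4π)·e^{−gam x²/4}`. -/
theorem zetaCoeff_bounds {Rc : ℝ} (hRc : 0 ≤ Rc) (x v : ℝ) :
    0 ≤ (8/5 - 3/2 : ℝ) / 2 * ((8/5 - 3/2 : ℝ) * Rc / (4 * Real.pi) * Real.exp (-((8/5 - 3/2) * (x ^ 2 + v ^ 2) / 4))) ∧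
      (8/5 - 3/2 : ℝ) / 2 * ((8/5 - 3/2 : ℝ) * Rc / (4 * Real.pi) * Real.exp (-((8/5 - 3/2) * (x ^ 2 + v ^ 2) / 4))) ≤ Rc ∧
      (8/5 - 3/2 : ℝ) / 2 * ((8/5 - 3/2 : ℝ) * Rc / (4 * Real.pi) * Real.exp (-((8/5 - 3/2) * (x ^ 2 + v ^ 2) / 4)))
        ≤ Rc * gaussE ((8/5 - 3/2 : ℝ) / 2) x := by
  have hπ : (3:ℝ) < Real.pi := Real.pi_gt_three
  have hexp1 : Real.exp (-((8/5 - 3/2 : ℝ) * (x ^ 2 + v ^ 2) / 4)) ≤ 1 := by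
    rw [Real.exp_le_one_iff]
    have : 0 ≤ (8/5 - 3/2 : ℝ) * (x ^ 2 + v ^ 2) / 4 := by positivity
    linarith
  have hexpg : Real.exp (-((8/5 - 3/2 : ℝ) * (x ^ 2 + v ^ 2) / 4)) ≤ gaussE ((8/5 - 3/2 : ℝ) / 2) x := by
    rw [gaussE, Real.exp_le_exp]; nlinarith [sq_nonneg v]
  have hc : (8/5 - 3/2 : ℝ) / 2 * ((8/5 - 3/2 : ℝ) * Rc / (4 * Real.pi)) ≤ Rc := by
    calc (8/5 - 3/2 : ℝ) / 2 * ((8/5 - 3/2 : ℝ) * Rc / (4 * Real.pi)) = Rc * ((8/5 - 3/2 : ℝ) / 2 * (8/5 - 3/2 : ℝ) / (4 * Real.pi)) := by ring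
      _ ≤ Rc * 1 := by
          gcongr
          rw [div_le_one (by positivity)]; nlinarith
      _ = Rc := mul_one _
  refine ⟨by positivity, ?_, ?_⟩
  · calc (8/5 - 3/2 : ℝ) / 2 * ((8/5 - 3/2 : ℝ) * Rc / (4 * Real.pi) * Real.exp (-((8/5 - 3/2) * (x ^ 2 + v ^ 2) / 4)))
        ≤ (8/5 - 3/2 : ℝ) / 2 * ((8/5 - 3/2 : ℝ) * Rc / (4 * Real.pi) * 1) := by gcongr
      _ = (8/5 - 3/2 : ℝ) / 2 * ((8/5 - 3/2 : ℝ) * Rc / (4 * Real.pi)) := by ring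
      _ ≤ Rc := hc
  · calc (8/5 - 3/2 : ℝ) / 2 * ((8/5 - 3/2 : ℝ) * Rc / (4 * Real.pi) * Real.exp (-((8/5 - 3/2) * (x ^ 2 + v ^ 2) / 4)))
        ≤ (8/5 - 3/2 : ℝ) / 2 * ((8/5 - 3/2 : ℝ) * Rc / (4 * Real.pi) * gaussE ((8/5 - 3/2 : ℝ) / 2) x) := by gcongr
      _ = ((8/5 - 3/2 : ℝ) / 2 * ((8/5 - 3/2 : ℝ) * Rc / (4 * Real.pi))) * gaussE ((8/5 - 3/2 : ℝ) / 2) x := by ring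
      _ ≤ Rc * gaussE ((8/5 - 3/2 : ℝ) / 2) x := mul_le_mul_of_nonneg_right hc (gaussE_pos _ _).le

/-! ## 3. The pointwise estimate -/

/-- The Hermite cancellation (`s = 5gam/2`): `(gam + 4b₁)p₂ + λ₂·v·p₃ + p₄ = 0` for `gam = 1/10`, `b₁ = 1/5`, `λ₂ = 3/10`. -/
theorem hermite_cancel (v : ℝ) :
    ((8/5 - 3/2 : ℝ) + 4 * (1/5)) * (lamW ^ 2 * v ^ 2 - lamW) + (3/10 : ℝ) * v * (-(lamW ^ 3 * v ^ 3) + 3 * lamW ^ 2 * v)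
      + (lamW ^ 4 * v ^ 4 - 6 * lamW ^ 3 * v ^ 2 + 3 * lamW ^ 2) = 0 := by
  simp only [lamW]; ring

/-- The Euler relation of the profile: `x·F₁(x) = A(x) − 4F₀(x)`, `A(x) = (χ₀′(log x/L)/L)·x⁻⁴`. -/
theorem euler_farProfile (L x : ℝ) :
    x * farProfile L 1 x = deriv bump12 (Real.log x / L) / L * (x ^ 4)⁻¹ - 4 * farProfile L 0 x := by
  rw [farProfile_one_eq]
  rcases eq_or_ne x 0 with rfl | hx
  · simp [farProfile]
  · field_simp


end Summit.NavierStokesRegularity.NavierStokesRegularity.Theorems.DefectColumnGate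

end
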